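import Summits.QuantumFields.BalabanUV.Beta.FP.ExpLocalisedBubbleMarginals

/-!
# `BalabanUV.Beta.FP.ExpLocalisedBubbleMixedPieces` — road «FP», N7 H-route, row H2-ASM-1 proper, part A (the pieces): THE DOUBLE (BUBBLE) SMEAR
# `Σ'_{x,x′,y,y′} c₀(x,x′)·c₁(y,y′)·F(z+y−x)·G(z+y′−x′)` of two zero-mass exponentially localised two-point weights against two legs with lattice Taylor data to
# order three: LEADING TERM (the four placements of two lattice derivatives) + REMAINDER `O((‖z‖∞+1)^{−(a+b+3)})`, the `hK` and `hdK` shapes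
# ([folklore] lattice power counting; nothing of the manuscripts)

HONEST DEPENDENCY (page 1, mandatory): continuum YM on T⁴ ⇐ BetaPertH ∧ nine spine estimates (0/9 proved); BetaPertH ⇐ (D1) ∧ (D4) ∧
CAP+tail; G-an2-4 gates asym, D1 and NE2/3/4.  HONEST FRAMING (cell contract, verbatim): «discharging `BetaPertH` makes Bałaban's UV
stability UNCONDITIONAL — a real constructive-QFT result; it is NOT the continuum limit and NOT the Clay problem.»  THIS MODULE is elementary [folklore] real
analysis on `ℤ⁴`, assembled BY NAME from the engine `FP/ExpLocalisedBubble{,Point,Product,Order2,Order2Point,Marginals}` (this lineage, g6–g8).  Every analytic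
input (the localisation of `c₀, c₁`, their ZERO TOTAL MASS, the decay of `F, G` and of their differences up to order three) is a HYPOTHESIS displayed in the
signatures; no `def`, no `Prop` fact, nothing cited, 0 sorry.
NOT the bubble of the perfect theory (the fibre∕colour sums, `Pker`, the admissible vertices are H2-ASM-2∕3's objects), NOT the tadpole, NOT `hgerm`, NOT `hasym`,
NOT D1, NOT BetaPertH, NOT continuum, NOT Clay.

ROW (road FP owner d1-p3-g6, `H2V-DESIGN.md` f78878bd5f8d2d18 §4 H2-ASM-1, R-FP-23 (c) first refusal of this lineage; CLAIM journal l.23466, silence-GO 23:55Z):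
«the DOUBLE smear … `= Σ_{i,i′∈Fin 2}Σ_{κκ′} m^{(i)}_κ(c₀)·m^{(i′)}_{κ′}(c_z)·𝔏_{ii′κκ′}[F,G](z) + R(z)` … BOTH lattice derivatives on the connecting line when the two moments
sit on legs joined by that line and ONE ON EACH line otherwise … every term of total degree < 2 vanishes by the zero masses; `|R(z)| ≤ C·(‖z‖∞+1)^{−7}` for
degree-2 legs; iterate `ExpLocalisedBubble.abs_smear_sub_order1_le` (inner smear at fixed outer pair carries the outer exponential weight)».

THE OBJECT (written out, no def): `B z := Σ'_{P : (Pt×Pt)×(Pt×Pt)} c₀ P.1 · c₁ P.2 · F (z + P.2.1 − P.1.1) · G (z + P.2.2 − P.1.2)` — `P.1 = (x,x′)` the two legs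
at vertex 0, `P.2 = (y,y′)` the two legs at the vertex at `z` (recentred to 0); component `.1` sits on line `F`, `.2` on line `G`.  MOMENTS: `m_j¹_κ := Σ' c_j p·(p.1)_κ`
(vertex `j`, `F`-leg), `m_j²_κ := Σ' c_j p·(p.2)_κ` (`G`-leg).  LEADING TERM:
`Lead z := −Σ_{κ,λ} [ m₀¹_κ m₁¹_λ·(G z·Δ_κΔ_λF z) + m₀¹_κ m₁²_λ·(Δ_κF z·Δ_λG z) + m₀²_κ m₁¹_λ·(Δ_λF z·Δ_κG z) + m₀²_κ m₁²_λ·(F z·Δ_κΔ_λG z) ]`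
(RULE: the moment of vertex `j` in leg `i`, direction `κ`, puts `Δ_κ` on LINE `i`; sign `−` from `s = y − x`).

CONTENT.
* §0 bookkeeping: `half_sum_symm_neg` (symmetrisation of second-moment coefficients), profiles of fibres, the line reindexing `tsum_lines_reindex`∕`summable_lines_reindex`, `summable_bubble`, `tsum_bubble_eq_lines`
  (`B z = Σ'_r S_r·G(z+r.1−r.2)`, `S_r := Σ'_q c₁(q.1,r.1)c₀(q.2,r.2)·F(z+q.1−q.2)` — the G-line pairs outside, the F-line pairs inside).
* §1 the three pieces: `abs_T1_sub_le` (weight `u₁⊗u₀` of mass marginals, order two on `G`), `abs_T2a_sub_le`∕`abs_T2b_sub_le` (weights `ν₁κ⊗u₀`, `u₁⊗ν₀κ`, order one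
  on `G`), `abs_inner_sub_le` (the inner F-smear at a fixed G-pair, order one, the outer exponential weight carried in the constant), `tsum_inner_eq` (Fubini: `Σ'_r S_r =`
  the F-smear against `v₁⊗v₀`), `abs_T3_sub_le` (order two on `F`).
NOT HERE: the assembly `|B z − Lead z| ≤ KR/(‖z‖∞+1)^{a+b+3}` and the `hK`∕`hdK` shapes — part B `FP/ExpLocalisedBubbleMixed`.
Unit `b2b-balaban-beta-d1-formalise-leaf-02` (gen 8).
-/

noncomputable section

namespace Summit.QuantumFields.BalabanUV.Beta.FP.ExpLocalisedBubbleMixedPieces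

open Finset Filter Topology fwdDiff
open scoped BigOperators
open Literature.MathematicalPhysics.QuantumFieldTheory.Balaban1983to89
open Literature.MathematicalPhysics.QuantumFieldTheory.Balaban1983to89.Beta
open B12Sec2to5 (l1 l1_nonneg abs_coord_le_l1)
open ExpKernelCalculus (Site Zl Zl_pos)
open Summit.QuantumFields.BalabanUV.Beta.FP.HorizontalBookkeepingTail (hasSum_mul)
open Summit.QuantumFields.BalabanUV.Beta.FP.ExpLocalisedBubble
open Summit.QuantumFields.BalabanUV.Beta.FP.ExpLocalisedBubblePoint
open Summit.QuantumFields.BalabanUV.Beta.FP.ExpLocalisedBubbleProduct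
open Summit.QuantumFields.BalabanUV.Beta.FP.ExpLocalisedBubbleOrder2
open Summit.QuantumFields.BalabanUV.Beta.FP.ExpLocalisedBubbleOrder2Point
open Summit.QuantumFields.BalabanUV.Beta.FP.ExpLocalisedBubbleMarginals
open DyadicShell (Pt supNorm supNorm_eq_zero_iff)

/-! ## §0 Bookkeeping -/

/-- [folklore] SYMMETRISATION: for a symmetric array `T`, `½·Σ_iΣ_j (−(u_i w_j + u_j w_i))·T i j = −Σ_iΣ_j w_i u_j·T i j`. -/
theorem half_sum_symm_neg (u w : Fin 4 → ℝ) (T : Fin 4 → Fin 4 → ℝ) (hT : ∀ i j, T i j = T j i) :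
    (1 / 2) * ∑ i, ∑ j, (-(u i * w j + u j * w i)) * T i j = -∑ i, ∑ j, w i * u j * T i j := by
  have h1 : ∑ i, ∑ j, u j * w i * T i j = ∑ i, ∑ j, w i * u j * T i j :=
    Finset.sum_congr rfl fun i _ => Finset.sum_congr rfl fun j _ => by ring
  have h2 : ∑ i, ∑ j, u i * w j * T i j = ∑ i, ∑ j, w i * u j * T i j := by
    rw [Finset.sum_comm]
    refine Finset.sum_congr rfl fun i _ => Finset.sum_congr rfl fun j _ => ?_
    rw [hT j i]; ring
  have e : ∑ i, ∑ j, (-(u i * w j + u j * w i)) * T i j = -(∑ i, ∑ j, u i * w j * T i j) - ∑ i, ∑ j, u j * w i * T i j := by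
    have : ∀ i j, (-(u i * w j + u j * w i)) * T i j = -(u i * w j * T i j) + -(u j * w i * T i j) := fun i j => by ring
    simp only [this, Finset.sum_add_distrib, Finset.sum_neg_distrib]
    ring
  rw [e, h1, h2]; ring

section Bubble

variable {c₀ c₁ : Pt × Pt → ℝ} {F G : Pt → ℝ} {C₀ C₁ δ A₀ A₁ A₂ A₃ B₀ B₁ B₂ B₃ : ℝ} {a b : ℕ}

/-- [folklore] A fibre of a two-point localised weight (second variable frozen) is a one-point profile. -/
theorem profile_snd {c : Pt × Pt → ℝ} {C : ℝ} (hc : ∀ p : Pt × Pt, |c p| ≤ C * (Real.exp (-δ * l1 p.1) * Real.exp (-δ * l1 p.2))) (x' : Pt) :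
    ∀ x : Pt, |c (x, x')| ≤ (C * Real.exp (-δ * l1 x')) * Real.exp (-δ * l1 x) := fun x => by
  have h := hc (x, x'); simp only at h; linarith [h, show C * (Real.exp (-δ * l1 x) * Real.exp (-δ * l1 x')) =
    (C * Real.exp (-δ * l1 x')) * Real.exp (-δ * l1 x) by ring]

/-- [folklore] A fibre of a two-point localised weight (first variable frozen) is a one-point profile. -/
theorem profile_fst {c : Pt × Pt → ℝ} {C : ℝ} (hc : ∀ p : Pt × Pt, |c p| ≤ C * (Real.exp (-δ * l1 p.1) * Real.exp (-δ * l1 p.2))) (x : Pt) :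
    ∀ x' : Pt, |c (x, x')| ≤ (C * Real.exp (-δ * l1 x)) * Real.exp (-δ * l1 x') := fun x' => by
  have h := hc (x, x'); simp only at h; linarith [h, show C * (Real.exp (-δ * l1 x) * Real.exp (-δ * l1 x')) =
    (C * Real.exp (-δ * l1 x)) * Real.exp (-δ * l1 x') by ring]

/-- [folklore] The decay letters imply the global bound `|F| ≤ A₀`. -/
theorem global_of_decay {H : Pt → ℝ} {A : ℝ} {m : ℕ} (h : ∀ t : Pt, |H t| ≤ A / ((supNorm t : ℝ) + 1) ^ m) : ∀ t, |H t| ≤ A :=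
  fun t => (h t).trans (div_le_self (nonneg_of_decay_pow h) (one_le_pow₀ (by have := (Nat.cast_nonneg (supNorm t) : (0:ℝ) ≤ _); linarith)))

/-- [folklore] THE REINDEXING OF THE FOUR LEGS BY LINES — `(r, q) ↦ ((q.2, r.2), (q.1, r.1))` (`r` = the pair on line `G`, `q` = the pair on line `F`) is an
involution of `(Pt×Pt)×(Pt×Pt)`; hence sums may be taken in the line-indexed order. -/
theorem tsum_lines_reindex (f : (Pt × Pt) × (Pt × Pt) → ℝ) :
    ∑' P : (Pt × Pt) × (Pt × Pt), f P = ∑' RQ : (Pt × Pt) × (Pt × Pt), f ((RQ.2.2, RQ.1.2), (RQ.2.1, RQ.1.1)) :=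
  ((Equiv.mk (fun RQ : (Pt × Pt) × (Pt × Pt) => ((RQ.2.2, RQ.1.2), (RQ.2.1, RQ.1.1)))
    (fun P : (Pt × Pt) × (Pt × Pt) => ((P.2.2, P.1.2), (P.2.1, P.1.1))) (fun _ => rfl) (fun _ => rfl)).tsum_eq f).symm

/-- [folklore] … and summability transports along the reindexing. -/
theorem summable_lines_reindex {f : (Pt × Pt) × (Pt × Pt) → ℝ} (hf : Summable f) :
    Summable fun RQ : (Pt × Pt) × (Pt × Pt) => f ((RQ.2.2, RQ.1.2), (RQ.2.1, RQ.1.1)) :=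
  (Equiv.mk (fun RQ : (Pt × Pt) × (Pt × Pt) => ((RQ.2.2, RQ.1.2), (RQ.2.1, RQ.1.1)))
    (fun P : (Pt × Pt) × (Pt × Pt) => ((P.2.2, P.1.2), (P.2.1, P.1.1))) (fun _ => rfl) (fun _ => rfl)).summable_iff.mpr hf

/-- **THE BUBBLE FAMILY IS SUMMABLE** (two localised weights, two bounded legs). [folklore] -/
theorem summable_bubble (hδ : 0 < δ)
    (hc₀ : ∀ p : Pt × Pt, |c₀ p| ≤ C₀ * (Real.exp (-δ * l1 p.1) * Real.exp (-δ * l1 p.2)))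
    (hc₁ : ∀ p : Pt × Pt, |c₁ p| ≤ C₁ * (Real.exp (-δ * l1 p.1) * Real.exp (-δ * l1 p.2)))
    {AF AG : ℝ} (hFA : ∀ t, |F t| ≤ AF) (hGA : ∀ t, |G t| ≤ AG) (z : Pt) :
    Summable fun P : (Pt × Pt) × (Pt × Pt) => c₀ P.1 * c₁ P.2 * F (z + P.2.1 - P.1.1) * G (z + P.2.2 - P.1.2) := by
  have hAF : 0 ≤ AF := (abs_nonneg _).trans (hFA 0)
  have hAG : 0 ≤ AG := (abs_nonneg _).trans (hGA 0)
  have h := ((summable_weight hδ hc₀).abs.mul_of_nonneg (summable_weight hδ hc₁).abs (fun _ => abs_nonneg _) (fun _ => abs_nonneg _)).mul_right (AF * AG)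
  refine Summable.of_norm_bounded h (fun P => ?_)
  rw [Real.norm_eq_abs, abs_mul, abs_mul, abs_mul]
  have h1 := hFA (z + P.2.1 - P.1.1); have h2 := hGA (z + P.2.2 - P.1.2)
  calc |c₀ P.1| * |c₁ P.2| * |F (z + P.2.1 - P.1.1)| * |G (z + P.2.2 - P.1.2)| ≤ |c₀ P.1| * |c₁ P.2| * AF * AG := by gcongr
    _ = |c₀ P.1| * |c₁ P.2| * (AF * AG) := by ring

/-- **THE BUBBLE BY LINES** (Fubini): `B z = Σ'_r S_r·G(z+r.1−r.2)` with the inner F-smear `S_r := Σ'_q c₁(q.1,r.1)·c₀(q.2,r.2)·F(z+q.1−q.2)` at the fixed G-pair `r`. [folklore] -/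
theorem tsum_bubble_eq_lines (hδ : 0 < δ)
    (hc₀ : ∀ p : Pt × Pt, |c₀ p| ≤ C₀ * (Real.exp (-δ * l1 p.1) * Real.exp (-δ * l1 p.2)))
    (hc₁ : ∀ p : Pt × Pt, |c₁ p| ≤ C₁ * (Real.exp (-δ * l1 p.1) * Real.exp (-δ * l1 p.2)))
    {AF AG : ℝ} (hFA : ∀ t, |F t| ≤ AF) (hGA : ∀ t, |G t| ≤ AG) (z : Pt) :
    ∑' P : (Pt × Pt) × (Pt × Pt), c₀ P.1 * c₁ P.2 * F (z + P.2.1 - P.1.1) * G (z + P.2.2 - P.1.2)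
      = ∑' r : Pt × Pt, (∑' q : Pt × Pt, (c₁ (q.1, r.1) * c₀ (q.2, r.2)) * F (z + q.1 - q.2)) * G (z + r.1 - r.2) := by
  have hs := summable_bubble hδ hc₀ hc₁ hFA hGA z
  rw [tsum_lines_reindex]
  have hs' := summable_lines_reindex hs
  rw [hs'.tsum_prod]
  refine tsum_congr fun r => ?_
  rw [← tsum_mul_right]
  exact tsum_congr fun q => by ring

/-! ## §1 The pieces -/

/-- **T1 — THE `(0,2)` PLACEMENT**: the G-smear against the product `u₁⊗u₀` of the MASS MARGINALS (zero mass, zero first moments) is the pure second-moment term: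
`|Σ'_r u₁(r.1)u₀(r.2)·G(z+r.1−r.2) − (−Σ_κΣ_λ m₀²_κ m₁²_λ·Δ_κΔ_λG z)| ≤ (C₁Zl)(C₀Zl)·K₂(G)/(‖z‖∞+1)^{b+3}`. [folklore] -/
theorem abs_T1_sub_le (hδ : 0 < δ)
    (hc₀ : ∀ p : Pt × Pt, |c₀ p| ≤ C₀ * (Real.exp (-δ * l1 p.1) * Real.exp (-δ * l1 p.2)))
    (hc₁ : ∀ p : Pt × Pt, |c₁ p| ≤ C₁ * (Real.exp (-δ * l1 p.1) * Real.exp (-δ * l1 p.2)))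
    (hm₀ : ∑' p : Pt × Pt, c₀ p = 0) (hm₁ : ∑' p : Pt × Pt, c₁ p = 0)
    (hG : ∀ t : Pt, |G t| ≤ B₀ / ((supNorm t : ℝ) + 1) ^ b ∧ (∀ i, |Δ_[(Pi.single i 1 : Pt)] G t| ≤ B₁ / ((supNorm t : ℝ) + 1) ^ (b + 1))
      ∧ (∀ i j, |Δ_[(Pi.single i 1 : Pt)] (Δ_[(Pi.single j 1 : Pt)] G) t| ≤ B₂ / ((supNorm t : ℝ) + 1) ^ (b + 2))
      ∧ (∀ i j l, |Δ_[(Pi.single i 1 : Pt)] (Δ_[(Pi.single j 1 : Pt)] (Δ_[(Pi.single l 1 : Pt)] G)) t| ≤ B₃ / ((supNorm t : ℝ) + 1) ^ (b + 3)))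
    (z : Pt) :
    |∑' r : Pt × Pt, (∑' y : Pt, c₁ (y, r.1)) * (∑' x : Pt, c₀ (x, r.2)) * G (z + r.1 - r.2)
        - (-∑ i, ∑ j, (∑' p : Pt × Pt, c₀ p * (p.2 i : ℝ)) * (∑' p : Pt × Pt, c₁ p * (p.2 j : ℝ))
            * Δ_[(Pi.single i 1 : Pt)] (Δ_[(Pi.single j 1 : Pt)] G) z)|
      ≤ (C₁ * Zl 4 δ) * (C₀ * Zl 4 δ) * K₂ δ B₀ B₁ B₂ B₃ b / ((supNorm z : ℝ) + 1) ^ (b + 3) := by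
  have hu₁ := abs_marginal_snd_le hδ hc₁
  have hu₀ := abs_marginal_snd_le hδ hc₀
  have hW := loc_of_product hu₁ hu₀
  have h := abs_smear_sub_order2_le_point hδ hW (fun t => (hG t).1) (fun t => (hG t).2.1) (fun t => (hG t).2.2.1) (fun t => (hG t).2.2.2) z
  -- the moments of the product weight
  have eM := tsum_product_weight hδ hu₁ hu₀
  have em := fun i => firstMoment_product hδ hu₁ hu₀ i
  have eMM := fun i j => secondMoment_product hδ hu₁ hu₀ i j
  have s₁ : ∑' y' : Pt, ∑' y : Pt, c₁ (y, y') = 0 := by rw [tsum_marginal_snd hδ hc₁, hm₁]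
  have s₀ : ∑' x' : Pt, ∑' x : Pt, c₀ (x, x') = 0 := by rw [tsum_marginal_snd hδ hc₀, hm₀]
  have t₁ := fun κ => tsum_mul_marginal_snd hδ hc₁ κ
  have t₀ := fun κ => tsum_mul_marginal_snd hδ hc₀ κ
  rw [eM, s₁, s₀] at h
  simp only [em, eMM, s₁, s₀, t₁, t₀, zero_mul, mul_zero, sub_zero, zero_sub, add_zero, Finset.sum_const_zero] at h
  -- symmetrise the second-moment term
  have hsym := half_sum_symm_neg (fun j => ∑' p : Pt × Pt, c₁ p * (p.2 j : ℝ)) (fun i => ∑' p : Pt × Pt, c₀ p * (p.2 i : ℝ))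
    (fun i j => Δ_[(Pi.single i 1 : Pt)] (Δ_[(Pi.single j 1 : Pt)] G) z) (fun i j => by rw [fwdDiff_comm])
  have e2 : (1 / 2) * ∑ i, ∑ j, (-((∑' p : Pt × Pt, c₁ p * (p.2 i : ℝ)) * (∑' p : Pt × Pt, c₀ p * (p.2 j : ℝ)))
        - (∑' p : Pt × Pt, c₁ p * (p.2 j : ℝ)) * (∑' p : Pt × Pt, c₀ p * (p.2 i : ℝ))) * Δ_[(Pi.single i 1 : Pt)] (Δ_[(Pi.single j 1 : Pt)] G) z
      = -∑ i, ∑ j, (∑' p : Pt × Pt, c₀ p * (p.2 i : ℝ)) * (∑' p : Pt × Pt, c₁ p * (p.2 j : ℝ))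
            * Δ_[(Pi.single i 1 : Pt)] (Δ_[(Pi.single j 1 : Pt)] G) z := by
    rw [← hsym]
    congr 1
    refine Finset.sum_congr rfl fun i _ => Finset.sum_congr rfl fun j _ => by ring
  rw [e2] at h
  exact h

/-- **T2a — A `(1,1)` PLACEMENT**: the G-smear against `ν₁κ⊗u₀` (moment marginal of `c₁` in its F-leg × mass marginal of `c₀`; zero mass):
`|Σ'_r ν₁κ(r.1)u₀(r.2)·G(z+r.1−r.2) − (−Σ_j m₁¹_κ m₀²_j·Δ_jG z)| ≤ (C₁Zm₁)(C₀Zl)·K₁(G)/(‖z‖∞+1)^{b+2}`. [folklore] -/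
theorem abs_T2a_sub_le (hδ : 0 < δ)
    (hc₀ : ∀ p : Pt × Pt, |c₀ p| ≤ C₀ * (Real.exp (-δ * l1 p.1) * Real.exp (-δ * l1 p.2)))
    (hc₁ : ∀ p : Pt × Pt, |c₁ p| ≤ C₁ * (Real.exp (-δ * l1 p.1) * Real.exp (-δ * l1 p.2)))
    (hm₀ : ∑' p : Pt × Pt, c₀ p = 0)
    (hG : ∀ t : Pt, |G t| ≤ B₀ / ((supNorm t : ℝ) + 1) ^ b ∧ (∀ i, |Δ_[(Pi.single i 1 : Pt)] G t| ≤ B₁ / ((supNorm t : ℝ) + 1) ^ (b + 1))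
      ∧ (∀ i j, |Δ_[(Pi.single i 1 : Pt)] (Δ_[(Pi.single j 1 : Pt)] G) t| ≤ B₂ / ((supNorm t : ℝ) + 1) ^ (b + 2))
      ∧ (∀ i j l, |Δ_[(Pi.single i 1 : Pt)] (Δ_[(Pi.single j 1 : Pt)] (Δ_[(Pi.single l 1 : Pt)] G)) t| ≤ B₃ / ((supNorm t : ℝ) + 1) ^ (b + 3)))
    (z : Pt) (κ : Fin 4) :
    |∑' r : Pt × Pt, (∑' y : Pt, (y κ : ℝ) * c₁ (y, r.1)) * (∑' x : Pt, c₀ (x, r.2)) * G (z + r.1 - r.2)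
        - (-∑ j, (∑' p : Pt × Pt, c₁ p * (p.1 κ : ℝ)) * (∑' p : Pt × Pt, c₀ p * (p.2 j : ℝ)) * Δ_[(Pi.single j 1 : Pt)] G z)|
      ≤ (C₁ * Zm δ 1) * (C₀ * Zl 4 δ) * K₁ δ B₀ B₁ B₂ b / ((supNorm z : ℝ) + 1) ^ (b + 2) := by
  have hν₁ := fun y' => abs_marginalMoment_snd_le hδ hc₁ y' κ
  have hu₀ := abs_marginal_snd_le hδ hc₀
  have hW := loc_of_product hν₁ hu₀
  have h := abs_smear_sub_order1_le_point' hδ hW (fun t => (hG t).1) (fun t => (hG t).2.1) (fun t => (hG t).2.2.1) z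
  have eM := tsum_product_weight hδ hν₁ hu₀
  have em := fun i => firstMoment_product hδ hν₁ hu₀ i
  have s₀ : ∑' x' : Pt, ∑' x : Pt, c₀ (x, x') = 0 := by rw [tsum_marginal_snd hδ hc₀, hm₀]
  have t₁ := tsum_marginalMoment_snd hδ hc₁ κ
  have t₀ := fun j => tsum_mul_marginal_snd hδ hc₀ j
  rw [eM, s₀] at h
  simp only [em, s₀, t₁, t₀, mul_zero, zero_mul, sub_zero, zero_sub, Finset.sum_neg_distrib, neg_mul] at h
  simpa only [Finset.sum_neg_distrib] using h

/-- **T2b — THE OTHER `(1,1)` PLACEMENT**: the G-smear against `u₁⊗ν₀κ`: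
`|Σ'_r u₁(r.1)ν₀κ(r.2)·G(z+r.1−r.2) − Σ_j m₁²_j m₀¹_κ·Δ_jG z| ≤ (C₁Zl)(C₀Zm₁)·K₁(G)/(‖z‖∞+1)^{b+2}`. [folklore] -/
theorem abs_T2b_sub_le (hδ : 0 < δ)
    (hc₀ : ∀ p : Pt × Pt, |c₀ p| ≤ C₀ * (Real.exp (-δ * l1 p.1) * Real.exp (-δ * l1 p.2)))
    (hc₁ : ∀ p : Pt × Pt, |c₁ p| ≤ C₁ * (Real.exp (-δ * l1 p.1) * Real.exp (-δ * l1 p.2)))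
    (hm₁ : ∑' p : Pt × Pt, c₁ p = 0)
    (hG : ∀ t : Pt, |G t| ≤ B₀ / ((supNorm t : ℝ) + 1) ^ b ∧ (∀ i, |Δ_[(Pi.single i 1 : Pt)] G t| ≤ B₁ / ((supNorm t : ℝ) + 1) ^ (b + 1))
      ∧ (∀ i j, |Δ_[(Pi.single i 1 : Pt)] (Δ_[(Pi.single j 1 : Pt)] G) t| ≤ B₂ / ((supNorm t : ℝ) + 1) ^ (b + 2))
      ∧ (∀ i j l, |Δ_[(Pi.single i 1 : Pt)] (Δ_[(Pi.single j 1 : Pt)] (Δ_[(Pi.single l 1 : Pt)] G)) t| ≤ B₃ / ((supNorm t : ℝ) + 1) ^ (b + 3)))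
    (z : Pt) (κ : Fin 4) :
    |∑' r : Pt × Pt, (∑' y : Pt, c₁ (y, r.1)) * (∑' x : Pt, (x κ : ℝ) * c₀ (x, r.2)) * G (z + r.1 - r.2)
        - ∑ j, (∑' p : Pt × Pt, c₁ p * (p.2 j : ℝ)) * (∑' p : Pt × Pt, c₀ p * (p.1 κ : ℝ)) * Δ_[(Pi.single j 1 : Pt)] G z|
      ≤ (C₁ * Zl 4 δ) * (C₀ * Zm δ 1) * K₁ δ B₀ B₁ B₂ b / ((supNorm z : ℝ) + 1) ^ (b + 2) := by
  have hu₁ := abs_marginal_snd_le hδ hc₁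
  have hν₀ := fun x' => abs_marginalMoment_snd_le hδ hc₀ x' κ
  have hW := loc_of_product hu₁ hν₀
  have h := abs_smear_sub_order1_le_point' hδ hW (fun t => (hG t).1) (fun t => (hG t).2.1) (fun t => (hG t).2.2.1) z
  have eM := tsum_product_weight hδ hu₁ hν₀
  have em := fun i => firstMoment_product hδ hu₁ hν₀ i
  have s₁ : ∑' y' : Pt, ∑' y : Pt, c₁ (y, y') = 0 := by rw [tsum_marginal_snd hδ hc₁, hm₁]
  have t₀ := tsum_marginalMoment_snd hδ hc₀ κ
  have t₁ := fun j => tsum_mul_marginal_snd hδ hc₁ j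
  rw [eM, s₁] at h
  simp only [em, s₁, t₁, t₀, zero_mul, sub_zero] at h
  exact h

/-- **THE INNER F-SMEAR AT A FIXED G-PAIR** (order one; the outer exponential weight is carried in the constant): with `S_r := Σ'_q c₁(q.1,r.1)c₀(q.2,r.2)·F(z+q.1−q.2)`,
`|S_r − u₁(r.1)u₀(r.2)·F z − Σ_κ (ν₁κ(r.1)u₀(r.2) − u₁(r.1)ν₀κ(r.2))·Δ_κF z| ≤ (C₀C₁·K₁(F)/(‖z‖∞+1)^{a+2})·e^{−δ|r.1|₁}e^{−δ|r.2|₁}` — a two-point weight in `r`. [folklore] -/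
theorem abs_inner_sub_le (hδ : 0 < δ)
    (hc₀ : ∀ p : Pt × Pt, |c₀ p| ≤ C₀ * (Real.exp (-δ * l1 p.1) * Real.exp (-δ * l1 p.2)))
    (hc₁ : ∀ p : Pt × Pt, |c₁ p| ≤ C₁ * (Real.exp (-δ * l1 p.1) * Real.exp (-δ * l1 p.2)))
    (hF : ∀ t : Pt, |F t| ≤ A₀ / ((supNorm t : ℝ) + 1) ^ a ∧ (∀ i, |Δ_[(Pi.single i 1 : Pt)] F t| ≤ A₁ / ((supNorm t : ℝ) + 1) ^ (a + 1))
      ∧ (∀ i j, |Δ_[(Pi.single i 1 : Pt)] (Δ_[(Pi.single j 1 : Pt)] F) t| ≤ A₂ / ((supNorm t : ℝ) + 1) ^ (a + 2))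
      ∧ (∀ i j l, |Δ_[(Pi.single i 1 : Pt)] (Δ_[(Pi.single j 1 : Pt)] (Δ_[(Pi.single l 1 : Pt)] F)) t| ≤ A₃ / ((supNorm t : ℝ) + 1) ^ (a + 3)))
    (z : Pt) (r : Pt × Pt) :
    |∑' q : Pt × Pt, (c₁ (q.1, r.1) * c₀ (q.2, r.2)) * F (z + q.1 - q.2)
        - (∑' y : Pt, c₁ (y, r.1)) * (∑' x : Pt, c₀ (x, r.2)) * F z
        - ∑ κ, ((∑' y : Pt, (y κ : ℝ) * c₁ (y, r.1)) * (∑' x : Pt, c₀ (x, r.2)) - (∑' y : Pt, c₁ (y, r.1)) * (∑' x : Pt, (x κ : ℝ) * c₀ (x, r.2)))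
            * Δ_[(Pi.single κ 1 : Pt)] F z|
      ≤ (C₀ * C₁ * K₁ δ A₀ A₁ A₂ a / ((supNorm z : ℝ) + 1) ^ (a + 2)) * (Real.exp (-δ * l1 r.1) * Real.exp (-δ * l1 r.2)) := by
  have hv := profile_snd hc₁ r.1
  have hv' := profile_snd hc₀ r.2
  have hW := loc_of_product hv hv'
  have h := abs_smear_sub_order1_le_point' hδ hW (fun t => (hF t).1) (fun t => (hF t).2.1) (fun t => (hF t).2.2.1) z
  rw [tsum_product_weight hδ hv hv'] at h
  simp only [firstMoment_product hδ hv hv'] at h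
  refine h.trans (le_of_eq ?_)
  ring

/-- **FUBINI FOR THE INNER SMEARS**: `Σ'_r S_r = Σ'_q v₁(q.1)v₀(q.2)·F(z+q.1−q.2)` with the mass marginals `v_j(x) := Σ'_{x′} c_j(x,x′)` (second variable summed). [folklore] -/
theorem tsum_inner_eq (hδ : 0 < δ)
    (hc₀ : ∀ p : Pt × Pt, |c₀ p| ≤ C₀ * (Real.exp (-δ * l1 p.1) * Real.exp (-δ * l1 p.2)))
    (hc₁ : ∀ p : Pt × Pt, |c₁ p| ≤ C₁ * (Real.exp (-δ * l1 p.1) * Real.exp (-δ * l1 p.2)))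
    {AF : ℝ} (hFA : ∀ t, |F t| ≤ AF) (z : Pt) :
    ∑' r : Pt × Pt, ∑' q : Pt × Pt, (c₁ (q.1, r.1) * c₀ (q.2, r.2)) * F (z + q.1 - q.2)
      = ∑' q : Pt × Pt, (∑' y' : Pt, c₁ (q.1, y')) * (∑' x' : Pt, c₀ (q.2, x')) * F (z + q.1 - q.2) := by
  have hAF : 0 ≤ AF := (abs_nonneg _).trans (hFA 0)
  -- summability of the two-line family
  have hw2 : Summable fun P : (Pt × Pt) × (Pt × Pt) => |c₀ P.1| * |c₁ P.2| :=
    (summable_weight hδ hc₀).abs.mul_of_nonneg (summable_weight hδ hc₁).abs (fun _ => abs_nonneg _) (fun _ => abs_nonneg _)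
  have hw2' : Summable fun RQ : (Pt × Pt) × (Pt × Pt) => |c₀ (RQ.2.2, RQ.1.2)| * |c₁ (RQ.2.1, RQ.1.1)| :=
    summable_lines_reindex hw2
  have hs : Summable (Function.uncurry fun (r q : Pt × Pt) => (c₁ (q.1, r.1) * c₀ (q.2, r.2)) * F (z + q.1 - q.2)) := by
    refine Summable.of_norm_bounded (hw2'.mul_right AF) (fun RQ => ?_)
    simp only [Function.uncurry, Real.norm_eq_abs, abs_mul]
    have := hFA (z + RQ.2.1 - RQ.2.2)
    calc |c₁ (RQ.2.1, RQ.1.1)| * |c₀ (RQ.2.2, RQ.1.2)| * |F (z + RQ.2.1 - RQ.2.2)| ≤ |c₁ (RQ.2.1, RQ.1.1)| * |c₀ (RQ.2.2, RQ.1.2)| * AF := by gcongr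
      _ = |c₀ (RQ.2.2, RQ.1.2)| * |c₁ (RQ.2.1, RQ.1.1)| * AF := by ring
  rw [← hs.tsum_comm]
  refine tsum_congr fun q => ?_
  have hv := profile_fst hc₁ q.1
  have hv' := profile_fst hc₀ q.2
  rw [← tsum_product_weight hδ hv hv', ← tsum_mul_right]

/-- **T3 — THE `(2,0)` PLACEMENT**: `|Σ'_r S_r − (−Σ_iΣ_j m₀¹_i m₁¹_j·Δ_iΔ_jF z)| ≤ (C₁Zl)(C₀Zl)·K₂(F)/(‖z‖∞+1)^{a+3}`. [folklore] -/
theorem abs_T3_sub_le (hδ : 0 < δ)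
    (hc₀ : ∀ p : Pt × Pt, |c₀ p| ≤ C₀ * (Real.exp (-δ * l1 p.1) * Real.exp (-δ * l1 p.2)))
    (hc₁ : ∀ p : Pt × Pt, |c₁ p| ≤ C₁ * (Real.exp (-δ * l1 p.1) * Real.exp (-δ * l1 p.2)))
    (hm₀ : ∑' p : Pt × Pt, c₀ p = 0) (hm₁ : ∑' p : Pt × Pt, c₁ p = 0)
    (hF : ∀ t : Pt, |F t| ≤ A₀ / ((supNorm t : ℝ) + 1) ^ a ∧ (∀ i, |Δ_[(Pi.single i 1 : Pt)] F t| ≤ A₁ / ((supNorm t : ℝ) + 1) ^ (a + 1))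
      ∧ (∀ i j, |Δ_[(Pi.single i 1 : Pt)] (Δ_[(Pi.single j 1 : Pt)] F) t| ≤ A₂ / ((supNorm t : ℝ) + 1) ^ (a + 2))
      ∧ (∀ i j l, |Δ_[(Pi.single i 1 : Pt)] (Δ_[(Pi.single j 1 : Pt)] (Δ_[(Pi.single l 1 : Pt)] F)) t| ≤ A₃ / ((supNorm t : ℝ) + 1) ^ (a + 3)))
    (z : Pt) :
    |∑' r : Pt × Pt, ∑' q : Pt × Pt, (c₁ (q.1, r.1) * c₀ (q.2, r.2)) * F (z + q.1 - q.2)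
        - (-∑ i, ∑ j, (∑' p : Pt × Pt, c₀ p * (p.1 i : ℝ)) * (∑' p : Pt × Pt, c₁ p * (p.1 j : ℝ))
            * Δ_[(Pi.single i 1 : Pt)] (Δ_[(Pi.single j 1 : Pt)] F) z)|
      ≤ (C₁ * Zl 4 δ) * (C₀ * Zl 4 δ) * K₂ δ A₀ A₁ A₂ A₃ a / ((supNorm z : ℝ) + 1) ^ (a + 3) := by
  rw [tsum_inner_eq hδ hc₀ hc₁ (global_of_decay fun t => (hF t).1) z]
  have hv₁ := abs_marginal_fst_le hδ hc₁
  have hv₀ := abs_marginal_fst_le hδ hc₀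
  have hW := loc_of_product hv₁ hv₀
  have h := abs_smear_sub_order2_le_point hδ hW (fun t => (hF t).1) (fun t => (hF t).2.1) (fun t => (hF t).2.2.1) (fun t => (hF t).2.2.2) z
  have eM := tsum_product_weight hδ hv₁ hv₀
  have em := fun i => firstMoment_product hδ hv₁ hv₀ i
  have eMM := fun i j => secondMoment_product hδ hv₁ hv₀ i j
  have s₁ : ∑' y : Pt, ∑' y' : Pt, c₁ (y, y') = 0 := by rw [tsum_marginal_fst hδ hc₁, hm₁]
  have s₀ : ∑' x : Pt, ∑' x' : Pt, c₀ (x, x') = 0 := by rw [tsum_marginal_fst hδ hc₀, hm₀]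
  have t₁ := fun κ => tsum_mul_marginal_fst hδ hc₁ κ
  have t₀ := fun κ => tsum_mul_marginal_fst hδ hc₀ κ
  rw [eM, s₁, s₀] at h
  simp only [em, eMM, s₁, s₀, t₁, t₀, zero_mul, mul_zero, sub_zero, zero_sub, add_zero, Finset.sum_const_zero] at h
  have hsym := half_sum_symm_neg (fun j => ∑' p : Pt × Pt, c₁ p * (p.1 j : ℝ)) (fun i => ∑' p : Pt × Pt, c₀ p * (p.1 i : ℝ))
    (fun i j => Δ_[(Pi.single i 1 : Pt)] (Δ_[(Pi.single j 1 : Pt)] F) z) (fun i j => by rw [fwdDiff_comm])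
  have e2 : (1 / 2) * ∑ i, ∑ j, (-((∑' p : Pt × Pt, c₁ p * (p.1 i : ℝ)) * (∑' p : Pt × Pt, c₀ p * (p.1 j : ℝ)))
        - (∑' p : Pt × Pt, c₁ p * (p.1 j : ℝ)) * (∑' p : Pt × Pt, c₀ p * (p.1 i : ℝ))) * Δ_[(Pi.single i 1 : Pt)] (Δ_[(Pi.single j 1 : Pt)] F) z
      = -∑ i, ∑ j, (∑' p : Pt × Pt, c₀ p * (p.1 i : ℝ)) * (∑' p : Pt × Pt, c₁ p * (p.1 j : ℝ))
            * Δ_[(Pi.single i 1 : Pt)] (Δ_[(Pi.single j 1 : Pt)] F) z := by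
    rw [← hsym]
    congr 1
    refine Finset.sum_congr rfl fun i _ => Finset.sum_congr rfl fun j _ => by ring
  rw [e2] at h
  exact h

end Bubble

end Summit.QuantumFields.BalabanUV.Beta.FP.ExpLocalisedBubbleMixedPieces

end
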